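import Summits.QuantumFields.YangMills.Theorems.UnitScaleTiltProp7CovWeightedRowScalings
import Summits.QuantumFields.YangMills.Theorems.UnitScaleTiltProp7CovPinJunkPhiSq
import Summits.QuantumFields.YangMills.Theorems.UnitScaleTiltProp7CovInteriorSubMeanValue
import HarnessLib

/-!
# Route `UnitScaleTilt`, crux K1 «MinimiserStabilityRegPr» (stmt-QuantumFields-19200), route-R E′ path (α′), (E1-b) covariant, row (hK₂-cov) — FILE F4b-cov (ii) «BRICKS»:
# the FAR row `‖V x‖ ≤ 2³⁵√𝓜_x∕(ℓ√ℓ)` (Kato + De Giorgi, frame-free), the pin CHARGE with the scale cutoff built in, and the scaled junk sums `J₁, J₂` at a pin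

Cell `ym3-torus`, width seat `ym3-torus-px11` (gen 3), LEAD of the (hK₂-cov) chain (routeR-w3 g6 WORDS (8)–(10), THE CUT 22:51:18Z: F4b∕F4c = px11); LOCATE 19200 evidence #57.
`--kind proof --supports stmt-QuantumFields-19200 --as helper`, count-neutral.  THEOREMS ONLY (0 `def`, 0 `sorry`).  YM₃ on T³ is a ladder rung (R3) — not d = 4, not infinite
volume, not a mass gap, not the Clay problem; nothing here claims the stub, the crux or the gap.

THE POINT.  Three bricks of the weighted row `w(x)·‖Δ_U(φ − φ_H)(x)‖ ≤ ℓM + A(1+2N²)²(1+t)²√𝓜∕√ℓ` (FILE (iii) ✓ `Prop7CovWeightedLaplaceRow`), for `V = Δ_Uφ_H` covariantly harmonic off the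
`k`-centres: FAR — every centre at `tdist > 12q` from `x` (`q = ⌊ℓ∕1024⌋`): ✓ `Prop7CovInteriorSubMeanValue.norm_sq_le_of_covHarmonic_off_of_far` on `B(x,12q)` with `R = 4q`
(`16·8064³∕(4q)³ ≤ 2⁷⁰∕ℓ³`); CHARGE — ✓ `Prop7CovPinCharge.norm_covLaplace_centre_le_of_cutoff` with `χ :=` ✓ `Prop7TorusAgmonWeight.exists_scale_cutoff y (ℓ := m∕10)` (`χ(y) = 1`,
`|Δ₁χ| ≤ 2700∕m²`, `χ = Δ₁χ = 0` off `B_m = {tdist(·,y) ≤ m}` since `5√3·m∕10 ≤ m − 1`) and `Φ := ‖Δ₁v‖`; JUNK — ✓ `J2_le`∕✓ `J1_le` in the scaled letters of FILE (i)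
(`J₂ ≤ 29088t²(1+t)²𝓜∕ℓ²`, `J₁ ≤ 1200t(1+t)√𝓜∕√ℓ`).  Plus the geometric letters: the punctured half-ball `{z ≠ y, tdist < L^k∕2} = {1 ≤ tdist ≤ ⌊(L^k−1)∕2⌋}`, harmonicity on the
punctured pin ball from harmonicity off the centres (✓ `pow_le_tdist_embIter_of_ne`), and the backward frame row from px4 g3's forward all-direction row.

WHAT IS PROVED (ns `…Theorems.Prop7CovWeightedRowBricks`; `L²`-op norm on `M_N(ℂ)`, `hs X = Σ_{jk}‖X_{jk}‖²`, `Δ_Uf x := divB T U (fun μ => covD T U μ f) x`).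
* §1 letters `ball_erase_eq_punctured`, `ball_half_subset`, `erase_ball_eq_punctured`, `sum_ball_mono`, `covHarmonic_near_pin_of_off_centres`, `backward_row_of_forward`,
  `laplace_one_eq_zero_of_vanish`, `pow_lt_sitesPerDir_zero`.
* §2 ★ `norm_le_far`; §3 ★★ `norm_covLaplace_pin_le`; §4 ★ `J2_scaled_le`, ★ `J1_scaled_le`.
HONEST SCOPE.  Bookkeeping over landed bricks; nothing of Bałaban's is asserted.

References: T. Bałaban, CMP 99 (1985) 389–434 [Balaban1985BackgroundPropagators] ((3.8) p.392, (3.35) p.396); CMP 96 (1984) 223–250 [Balaban1984PropagatorsII] ((1.9) p.226);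
CMP 95 (1984) 17–40 [Balaban1984PropagatorsI] ((1.18) p.20); M. Giaquinta, Princeton UP 1983 [Giaquinta1984] (Ch. III §2).
-/

set_option autoImplicit false

noncomputable section

open scoped BigOperators Matrix.Norms.L2Operator Matrix

namespace Summit.QuantumFields.YangMills.Theorems.Prop7CovWeightedRowBricks

open Literature.MathematicalPhysics.QuantumFieldTheory.Balaban1983to89
open Finset
open LatticeFieldCalculus (laplace)
open B9Eq39Adjoint (R covD divB)
open B9TorusCalculus (torusT torusT_apply)
open B3Taylor310LocalRemainder (tdist_comm tdist_self tdist_triangle)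
open B15DeterminingSets (embIter)
open Summit.QuantumFields.YangMills.Theorems.Prop7CovPinJunkSums (tdist_shift_le_succ tdist_le_tdist_shift_succ norm_le_sqrt_hs)
open Summit.QuantumFields.YangMills.Theorems.Prop7CovPinCharge (norm_framed_eq norm_covLaplace_centre_le_of_cutoff)
open Summit.QuantumFields.YangMills.Theorems.Prop7CovPinJunkPhi (J1_le norm_le_sqrt_mass norm_covD_le_add tdist_unshift_le_succ sum_punctured_le_ball)
open Summit.QuantumFields.YangMills.Theorems.Prop7CovPinJunkPhiSq (J2_le norm_laplace_framed_centre_le)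
open Summit.QuantumFields.YangMills.Theorems.Prop7CovInteriorSubMeanValue (norm_sq_le_of_covHarmonic_off_of_far)
open Summit.QuantumFields.YangMills.Theorems.Prop7InterpErrorPinAbstract (tdist_pos_of_ne)
open Summit.QuantumFields.YangMills.Theorems.Prop7PinnedKernelGeometry (pow_le_tdist_embIter_of_ne)
open Summit.QuantumFields.YangMills.Theorems.Prop7TorusAgmonWeight (exists_scale_cutoff)
open Summit.QuantumFields.YangMills.Theorems.Prop7TorusRadialSums (card_ball_le_real)
open Summit.QuantumFields.YangMills.Theorems.Prop7CovWeightedRowScalings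

variable {P : Params} {N : ℕ}

/-! ## §1 Geometric letters -/

section Letters

/-- The punctured half-ball in both spellings: `{z ≠ y, tdist(z,y) < L^k∕2} = {1 ≤ tdist(z,y) ≤ m}`, `m = ⌊(L^k−1)∕2⌋`. [folklore] -/
theorem ball_erase_eq_punctured {j : ℕ} (y : Site P j) {L k : ℕ} (hℓ : 1024 ≤ L ^ k) :
    (Finset.univ.filter (fun z : Site P j => (Site.tdist z y : ℝ) < (L : ℝ) ^ k / 2)).erase y
      = Finset.univ.filter (fun z : Site P j => 1 ≤ Site.tdist z y ∧ Site.tdist z y ≤ (L ^ k - 1) / 2) := by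
  classical
  obtain ⟨-, -, -, hiff⟩ := half_letters hℓ
  have hc : ((L : ℝ) ^ k) = ((L ^ k : ℕ) : ℝ) := by push_cast; rfl
  ext z
  simp only [Finset.mem_erase, Finset.mem_filter, Finset.mem_univ, true_and, hc]
  constructor
  · rintro ⟨hne, hlt⟩
    exact ⟨tdist_pos_of_ne hne, (hiff _).1 hlt⟩
  · rintro ⟨h1, hle⟩
    refine ⟨fun h => ?_, (hiff _).2 hle⟩
    rw [h, tdist_self] at h1; omega

/-- The half-ball sits in every `r`-ball with `r ≥ m`. [folklore] -/
theorem ball_half_subset {j : ℕ} (y : Site P j) {L k : ℕ} (hℓ : 1024 ≤ L ^ k) (r : ℕ) (hr : (L ^ k - 1) / 2 ≤ r) :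
    Finset.univ.filter (fun z : Site P j => (Site.tdist z y : ℝ) < (L : ℝ) ^ k / 2) ⊆ Finset.univ.filter (fun z : Site P j => Site.tdist z y ≤ r) := by
  obtain ⟨-, -, -, hiff⟩ := half_letters hℓ
  have hc : ((L : ℝ) ^ k) = ((L ^ k : ℕ) : ℝ) := by push_cast; rfl
  intro z hz
  rw [Finset.mem_filter] at hz ⊢
  rw [hc] at hz
  exact ⟨hz.1, ((hiff _).1 hz.2).trans hr⟩

/-- The punctured ball in both spellings: `B_m ∖ {y} = {1 ≤ tdist(·,y) ≤ m}`. [folklore] -/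
theorem erase_ball_eq_punctured {j : ℕ} (y : Site P j) (m : ℕ) :
    (Finset.univ.filter (fun z : Site P j => Site.tdist z y ≤ m)).erase y
      = Finset.univ.filter (fun z : Site P j => 1 ≤ Site.tdist z y ∧ Site.tdist z y ≤ m) := by
  classical
  ext z
  simp only [Finset.mem_erase, Finset.mem_filter, Finset.mem_univ, true_and]
  constructor
  · rintro ⟨hne, hle⟩
    exact ⟨tdist_pos_of_ne hne, hle⟩
  · rintro ⟨h1, hle⟩
    refine ⟨fun h => ?_, hle⟩
    rw [h, tdist_self] at h1; omega

/-- Ball masses are monotone in the radius (nonnegative summands). [folklore] -/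
theorem sum_ball_mono {j : ℕ} (y : Site P j) {r r' : ℕ} (hr : r ≤ r') (f : Site P j → ℝ) (hf : ∀ z, 0 ≤ f z) :
    ∑ z ∈ Finset.univ.filter (fun z : Site P j => Site.tdist z y ≤ r), f z ≤ ∑ z ∈ Finset.univ.filter (fun z : Site P j => Site.tdist z y ≤ r'), f z := by
  classical
  refine Finset.sum_le_sum_of_subset_of_nonneg (fun z hz => ?_) fun z _ _ => hf z
  rw [Finset.mem_filter] at hz ⊢
  exact ⟨hz.1, hz.2.trans hr⟩

/-- **HARMONIC ON THE PUNCTURED PIN BALL**: if `Δ_UV = 0` off the `k`-centres (`k ≤ m_P + K_P`), then around each centre `y = embIter k y₀` the field is covariantly harmonic on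
`{0 < tdist(·,y) < L^k}` — the other centres are `L^k` away (✓ `pow_le_tdist_embIter_of_ne`). [cite: Balaban1984PropagatorsI, (1.18) p.20] -/
theorem covHarmonic_near_pin_of_off_centres {k : ℕ} (hk : k ≤ P.m + P.K) {E : Type*} (F : Site P 0 → E) (e0 : E)
    (hF : ∀ x : Site P 0, x ∉ Set.range (embIter (P := P) k) → F x = e0) (y₀ : Site P k) {r : ℕ} (hr : r < P.L ^ k)
    (z : Site P 0) (hz0 : 0 < Site.tdist z (embIter k y₀)) (hzr : Site.tdist z (embIter k y₀) ≤ r) : F z = e0 := by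
  refine hF z fun ⟨y₁, hy₁⟩ => ?_
  by_cases hne : y₁ = y₀
  · rw [hne] at hy₁; rw [← hy₁, tdist_self] at hz0; exact lt_irrefl _ hz0
  · have h := pow_le_tdist_embIter_of_ne hk hne
    rw [hy₁] at h; omega

/-- **BACKWARD ROW FROM THE FORWARD ROW**: the all-direction forward difference row of the framed links on the `(r+1)`-ball gives the same-direction backward row on the `r`-ball.
[cite: Balaban1985BackgroundPropagators, (3.35) p.396] -/
theorem backward_row_of_forward {j : ℕ} (U : Fin P.d → Site P j → (Matrix (Fin N) (Fin N) ℂ)ˣ) (Fr : Site P j → (Matrix (Fin N) (Fin N) ℂ)ˣ) (y : Site P j) {r : ℕ} {τ₂ : ℝ}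
    (h : ∀ (μ ν : Fin P.d) (x : Site P j), Site.tdist x y ≤ r + 1 →
      ‖(((Fr (torusT P j ν x))⁻¹ * U μ (torusT P j ν x) * Fr (torusT P j μ (torusT P j ν x)) : (Matrix (Fin N) (Fin N) ℂ)ˣ) : Matrix (Fin N) (Fin N) ℂ)
          - (((Fr x)⁻¹ * U μ x * Fr (torusT P j μ x) : (Matrix (Fin N) (Fin N) ℂ)ˣ) : Matrix (Fin N) (Fin N) ℂ)‖ ≤ τ₂)
    (μ : Fin P.d) (z : Site P j) (hz : Site.tdist z y ≤ r) :
    ‖(((Fr z)⁻¹ * U μ z * Fr (torusT P j μ z) : (Matrix (Fin N) (Fin N) ℂ)ˣ) : Matrix (Fin N) (Fin N) ℂ)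
        - (((Fr (z.unshift μ))⁻¹ * U μ (z.unshift μ) * Fr (torusT P j μ (z.unshift μ)) : (Matrix (Fin N) (Fin N) ℂ)ˣ) : Matrix (Fin N) (Fin N) ℂ)‖ ≤ τ₂ := by
  have hx : Site.tdist (z.unshift μ) y ≤ r + 1 := (tdist_unshift_le_succ z y μ).trans (by omega)
  have h1 := h μ μ (z.unshift μ) hx
  have e : torusT P j μ (z.unshift μ) = z := by rw [torusT_apply, Site.shift_unshift]
  rw [e] at h1
  rw [e]; exact h1

/-- A real site function vanishing at `x` and its nearest neighbours has `Δ₁ = 0` at `x`. [folklore] -/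
theorem laplace_one_eq_zero_of_vanish {j : ℕ} (χ : Site P j → ℝ) (x : Site P j) (h0 : χ x = 0) (h1 : ∀ μ, χ (x.shift μ) = 0) (h2 : ∀ μ, χ (x.unshift μ) = 0) :
    laplace 1 χ x = 0 := by
  simp only [laplace, h0, h1, h2, one_pow, one_smul, add_zero, sub_zero, Finset.sum_const_zero]

/-- `L^k ≤ sitesPerDir 0` in the standing range. [cite: Balaban1987RG1, (0.1) p.251] -/
theorem pow_lt_sitesPerDir_zero {k : ℕ} (hk : k ≤ P.m + P.K) : P.L ^ k < P.sitesPerDir 0 := by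
  have h1 : P.L ^ k ≤ P.L ^ (P.m + P.K) := Nat.pow_le_pow_right P.L_pos hk
  have h2 : P.sitesPerDir 0 = 2 * P.L ^ (P.m + P.K - 0) := rfl
  rw [h2, Nat.sub_zero]
  have h3 : 0 < P.L ^ (P.m + P.K) := pow_pos P.L_pos _
  omega

end Letters

/-! ## §2 ★ The FAR row (Kato + De Giorgi on the ball `B(x, 12q)`, frame-free) -/

section Far

/-- ★ **THE FAR ROW**: if `V` is covariantly harmonic off the `k`-centres and every centre is at `tdist > 12q` from `x` (`q = ⌊L^k∕1024⌋ ≥ 1`), then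
`‖V x‖ ≤ 2³⁵∕(ℓ√ℓ) · √(Σ_{tdist(z,x) ≤ ℓ} hs V(z))`, `ℓ = L^k` (✓ `Prop7CovInteriorSubMeanValue.norm_sq_le_of_covHarmonic_off_of_far` with `R = 4q`, `ρ = 12q`, `16·8064³∕(4q)³ ≤ 2⁷⁰∕ℓ³`).
[cite: Balaban1985BackgroundPropagators, (3.8) p.392; Giaquinta1984, Ch. III §2] -/
theorem norm_le_far (hd : P.d = 3) {k : ℕ} (hk : k ≤ P.m + P.K) (hℓ : 1024 ≤ P.L ^ k)
    (U : Fin P.d → Site P 0 → (Matrix (Fin N) (Fin N) ℂ)ˣ)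
    (hU : ∀ (κ : Fin P.d) (y : Site P 0), ‖(U κ y : Matrix (Fin N) (Fin N) ℂ)‖ ≤ 1 ∧ ‖(((U κ y)⁻¹ : (Matrix (Fin N) (Fin N) ℂ)ˣ) : Matrix (Fin N) (Fin N) ℂ)‖ ≤ 1)
    (V : Site P 0 → Matrix (Fin N) (Fin N) ℂ)
    (hV : ∀ x : Site P 0, x ∉ Set.range (embIter (P := P) k) → divB (torusT P 0) U (fun μ => covD (torusT P 0) U μ V) x = 0)
    (x : Site P 0) (hfar : ∀ y₀ : Site P k, 12 * (P.L ^ k / 1024) < Site.tdist x (embIter k y₀)) :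
    ‖V x‖ ≤ 2 ^ 35 / (((P.L : ℝ) ^ k) * Real.sqrt ((P.L : ℝ) ^ k))
        * Real.sqrt (∑ z ∈ Finset.univ.filter (fun z : Site P 0 => Site.tdist z x ≤ P.L ^ k), ∑ j : Fin N, ∑ k' : Fin N, ‖(V z) j k'‖ ^ 2) := by
  classical
  obtain ⟨hq1, hqℓ, hqℓ'⟩ := quotient_letters hℓ
  set q : ℕ := P.L ^ k / 1024 with hq
  set Mass := ∑ z ∈ Finset.univ.filter (fun z : Site P 0 => Site.tdist z x ≤ P.L ^ k), ∑ j : Fin N, ∑ k' : Fin N, ‖(V z) j k'‖ ^ 2 with hMass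
  have hMass0 : 0 ≤ Mass := Finset.sum_nonneg fun _ _ => Finset.sum_nonneg fun _ _ => Finset.sum_nonneg fun _ _ => sq_nonneg _
  have hd1 : 1 ≤ P.d := by rw [hd]; norm_num
  have hR : 4 ≤ 4 * q := by omega
  have hN : 2 * (4 * q) < P.sitesPerDir 0 := lt_of_lt_of_le (by omega) (pow_lt_sitesPerDir_zero hk).le
  have hρ : (P.d : ℝ) * ((4 * q : ℕ) : ℝ) ≤ ((12 * q : ℕ) : ℝ) := by rw [hd]; push_cast; linarith
  have hfar' : ∀ z : Site P 0, (Site.tdist z x : ℝ) ≤ ((12 * q : ℕ) : ℝ) → z ∉ Set.range (embIter (P := P) k) := by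
    rintro z hz ⟨y₀, rfl⟩
    have h := hfar y₀
    rw [tdist_comm] at h
    have hz' : Site.tdist (embIter k y₀) x ≤ 12 * q := by exact_mod_cast hz
    omega
  have h := norm_sq_le_of_covHarmonic_off_of_far hd1 U hU V (Set.range (embIter (P := P) k)) hV x hR hN hρ hfar'
  -- constants: `d = 3`, `16·8064³∕(4q)³ ≤ 2⁷⁰∕ℓ³`
  have e3 : (16 * (336 * (P.d : ℝ) * (2 : ℝ) ^ P.d) ^ P.d / (((4 * q : ℕ) : ℝ)) ^ P.d) = 16 * (336 * (3 : ℝ) * (2 : ℝ) ^ 3) ^ 3 / (((4 * q : ℕ) : ℝ)) ^ 3 := by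
    rw [hd]; norm_num
  rw [e3] at h
  have hL0 : (0 : ℝ) < (P.L : ℝ) := by exact_mod_cast P.L_pos
  have hℓpos : (0 : ℝ) < (P.L : ℝ) ^ k := pow_pos hL0 k
  have hℓR : (P.L : ℝ) ^ k ≤ 512 * (((4 * q : ℕ) : ℝ)) := by
    have h' : ((P.L ^ k : ℕ) : ℝ) < ((2048 * q : ℕ) : ℝ) := by exact_mod_cast hqℓ'
    push_cast at h' ⊢; linarith
  have hconst := far_const_le hℓpos hℓR
  -- the ball mass in `hs`
  have hball : ∑ z ∈ Finset.univ.filter (fun z : Site P 0 => (Site.tdist z x : ℝ) ≤ ((12 * q : ℕ) : ℝ)), ‖V z‖ ^ 2 ≤ Mass := by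
    rw [hMass]
    refine Finset.sum_le_sum_of_subset_of_nonneg (fun z hz => ?_) (fun z _ _ => ?_) |>.trans' (Finset.sum_le_sum fun z _ => MatrixNorms.opNorm_sq_le_sum_norm_sq (V z))
    · rw [Finset.mem_filter] at hz ⊢
      have hz' : Site.tdist z x ≤ 12 * q := by exact_mod_cast hz.2
      exact ⟨hz.1, by omega⟩
    · exact Finset.sum_nonneg fun _ _ => Finset.sum_nonneg fun _ _ => sq_nonneg _
  have hsq : ‖V x‖ ^ 2 ≤ 2 ^ 70 / ((P.L : ℝ) ^ k) ^ 3 * Mass :=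
    h.trans (mul_le_mul hconst hball (Finset.sum_nonneg fun _ _ => sq_nonneg _) (by positivity))
  -- square root
  obtain ⟨hr1, -, hrr, hr3⟩ := sqrt_letters (one_le_pow₀ (by exact_mod_cast P.L_pos : (1 : ℝ) ≤ P.L) : (1 : ℝ) ≤ (P.L : ℝ) ^ k)
  have hC0 : 0 ≤ 2 ^ 35 / (((P.L : ℝ) ^ k) * Real.sqrt ((P.L : ℝ) ^ k)) * Real.sqrt Mass := by positivity
  have e : (2 ^ 35 / (((P.L : ℝ) ^ k) * Real.sqrt ((P.L : ℝ) ^ k)) * Real.sqrt Mass) ^ 2 = 2 ^ 70 / ((P.L : ℝ) ^ k) ^ 3 * Mass := by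
    rw [mul_pow, div_pow, mul_pow, Real.sq_sqrt hMass0, Real.sq_sqrt hℓpos.le]; ring
  rw [← e] at hsq
  exact (pow_le_pow_iff_left₀ (norm_nonneg _) hC0 two_ne_zero).1 hsq

end Far

/-! ## §3 ★★ The CHARGE at a pin with the scale cutoff built in -/

section Charge

/-- ★★ **THE PIN CHARGE WITH THE SCALE-`m∕10` CUTOFF**: for bi-contractive `U`, `Fr`, any matrix field `V`, a pin `y`, `m ≥ 16`, and the framed-link rows at the pin,
`‖Δ_UV(y)‖ ≤ 2N²·((2700∕m²)·√#B_m·√(Σ_{B_m}‖V‖²) + Σ_{B_m∖y}‖Δ₁v‖) + [pin comparison]`, `B_m = {tdist(·,y) ≤ m}`, `v = R(Fr⁻¹)V` — ✓ `Prop7CovPinCharge.norm_covLaplace_centre_le_of_cutoff`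
with `χ` := ✓ `exists_scale_cutoff y (ℓ := m∕10)` (`χ(y) = 1`, `|Δ₁χ| ≤ 27·100∕m²`, `χ = Δ₁χ = 0` off `B_m` since `5√3·m∕10 ≤ m − 1`) and `Φ := ‖Δ₁v‖`.
[cite: Balaban1984PropagatorsII, (1.9) p.226; Balaban1985BackgroundPropagators, (3.35) p.396] -/
theorem norm_covLaplace_pin_le (hd : P.d = 3) {j : ℕ}
    (U : Fin P.d → Site P j → (Matrix (Fin N) (Fin N) ℂ)ˣ)
    (hU : ∀ (κ : Fin P.d) (w : Site P j), ‖(U κ w : Matrix (Fin N) (Fin N) ℂ)‖ ≤ 1 ∧ ‖(((U κ w)⁻¹ : (Matrix (Fin N) (Fin N) ℂ)ˣ) : Matrix (Fin N) (Fin N) ℂ)‖ ≤ 1)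
    (Fr : Site P j → (Matrix (Fin N) (Fin N) ℂ)ˣ)
    (hFr : ∀ z, ‖(Fr z : Matrix (Fin N) (Fin N) ℂ)‖ ≤ 1 ∧ ‖(((Fr z)⁻¹ : (Matrix (Fin N) (Fin N) ℂ)ˣ) : Matrix (Fin N) (Fin N) ℂ)‖ ≤ 1)
    (V : Site P j → Matrix (Fin N) (Fin N) ℂ) (y : Site P j) {m : ℕ} (hm : 16 ≤ m) {τ₁ τ₂ : ℝ}
    (h1 : ∀ μ, ‖(((Fr y)⁻¹ * U μ y * Fr (torusT P j μ y) : (Matrix (Fin N) (Fin N) ℂ)ˣ) : Matrix (Fin N) (Fin N) ℂ) - 1‖ ≤ τ₁)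
    (h1' : ∀ μ, ‖(((Fr (y.unshift μ))⁻¹ * U μ (y.unshift μ) * Fr (torusT P j μ (y.unshift μ)) : (Matrix (Fin N) (Fin N) ℂ)ˣ) : Matrix (Fin N) (Fin N) ℂ) - 1‖ ≤ τ₁)
    (h2 : ∀ μ, ‖(((Fr y)⁻¹ * U μ y * Fr (torusT P j μ y) : (Matrix (Fin N) (Fin N) ℂ)ˣ) : Matrix (Fin N) (Fin N) ℂ)
        - (((Fr (y.unshift μ))⁻¹ * U μ (y.unshift μ) * Fr (torusT P j μ (y.unshift μ)) : (Matrix (Fin N) (Fin N) ℂ)ˣ) : Matrix (Fin N) (Fin N) ℂ)‖ ≤ τ₂) :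
    ‖divB (torusT P j) U (fun μ => covD (torusT P j) U μ V) y‖
      ≤ 2 * (N : ℝ) ^ 2 * (2700 / (m : ℝ) ^ 2 * (Real.sqrt ((Finset.univ.filter (fun x : Site P j => Site.tdist x y ≤ m)).card : ℝ)
              * Real.sqrt (∑ x ∈ Finset.univ.filter (fun x : Site P j => Site.tdist x y ≤ m), ‖V x‖ ^ 2))
            + ∑ x ∈ (Finset.univ.filter (fun x : Site P j => Site.tdist x y ≤ m)).erase y, ‖laplace 1 (fun w => R (Fr w)⁻¹ (V w)) x‖)
        + ∑ μ : Fin P.d, (2 * τ₁ * (‖covD (torusT P j) U μ V y‖ + ‖covD (torusT P j) U μ V (y.unshift μ)‖ + 2 * τ₁ * (‖V (y.shift μ)‖ + ‖V y‖))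
          + (2 * τ₂ + 4 * τ₁ ^ 2) * ‖V (y.unshift μ)‖) := by
  classical
  have hd' : (P.d : ℝ) = 3 := by exact_mod_cast hd
  have hm0 : (16 : ℝ) ≤ m := by exact_mod_cast hm
  have hρ : (1 : ℝ) ≤ (m : ℝ) / 10 := by rw [le_div_iff₀ (by norm_num)]; linarith
  obtain ⟨χ, h01, hone, hzero, -, -, -, hlap⟩ := exists_scale_cutoff y hρ
  have hχy : χ y = 1 := hone y (by rw [tdist_self]; push_cast; positivity)
  have hB : ∀ x, |laplace 1 χ x| ≤ 2700 / (m : ℝ) ^ 2 := by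
    intro x
    refine (hlap 1 x).trans (le_of_eq ?_)
    rw [hd']; field_simp; norm_num
  have hχ1 : ∀ x, |χ x| ≤ 1 := fun x => abs_le.2 ⟨by linarith [(h01 x).1], (h01 x).2⟩
  -- `χ = 0` at `tdist ≥ m` (`5√3·(m∕10) ≤ m`)
  have hs3 : Real.sqrt (P.d : ℝ) ≤ 2 := by
    rw [hd']
    have h := Real.sqrt_le_sqrt (by norm_num : (3 : ℝ) ≤ 2 ^ 2)
    rwa [Real.sqrt_sq (by norm_num : (0:ℝ) ≤ 2)] at h
  have hvan : ∀ x, m ≤ Site.tdist x y → χ x = 0 := by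
    intro x hx
    refine hzero x ?_
    have hx' : (m : ℝ) ≤ Site.tdist x y := by exact_mod_cast hx
    have h0 : 0 ≤ Real.sqrt (P.d : ℝ) := Real.sqrt_nonneg _
    nlinarith
  set Bm := Finset.univ.filter (fun x : Site P j => Site.tdist x y ≤ m) with hBm
  have hout : ∀ x ∉ Bm, m + 1 ≤ Site.tdist x y := by
    intro x hx
    rw [hBm, Finset.mem_filter] at hx
    by_contra h
    exact hx ⟨Finset.mem_univ _, by omega⟩
  have hS' : ∀ x ∉ Bm, χ x = 0 := fun x hx => hvan x (by have := hout x hx; omega)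
  have hS : ∀ x ∉ Bm, laplace 1 χ x = 0 := by
    intro x hx
    have hx1 := hout x hx
    refine laplace_one_eq_zero_of_vanish χ x (hvan x (by omega)) (fun μ => hvan _ ?_) (fun μ => hvan _ ?_)
    · have h := tdist_le_tdist_shift_succ x y μ; omega
    · have h := tdist_shift_le_succ (x.unshift μ) y μ
      rw [Site.shift_unshift] at h; omega
  exact norm_covLaplace_centre_le_of_cutoff U Fr hU hFr V y h1 h1' h2 χ hχy hB hχ1 Bm hS Bm hS' (fun x => ‖laplace 1 (fun w => R (Fr w)⁻¹ (V w)) x‖)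
    (fun x _ => le_rfl)

end Charge

/-! ## §4 ★ The scaled junk sums at a pin (generic level, pin `y`, half-radius `m ≥ 16`, scale `ℓ ≥ 2m+1`, frames `τ₁ ≤ t∕ℓ`, `τ₂ ≤ t∕ℓ²`) -/

section Junk

variable {j : ℕ} (U : Fin P.d → Site P j → (Matrix (Fin N) (Fin N) ℂ)ˣ) (Fr : Site P j → (Matrix (Fin N) (Fin N) ℂ)ˣ)

/-- ★ **`J₂` SCALED**: `Σ_{0<s≤m} s²‖Δ₁v‖² ≤ 29088·t²(1+t)²∕ℓ² · 𝓜` (✓ `J2_le` + `cJ2_le`). [cite: Giaquinta1984, Ch. III §2; Balaban1985BackgroundPropagators, (3.35) p.396] -/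
theorem J2_scaled_le (hd : P.d = 3) (hUu : ∀ ν x, (U ν x : Matrix (Fin N) (Fin N) ℂ) ∈ unitary (Matrix (Fin N) (Fin N) ℂ))
    (hU : ∀ (κ : Fin P.d) (w : Site P j), ‖(U κ w : Matrix (Fin N) (Fin N) ℂ)‖ ≤ 1 ∧ ‖(((U κ w)⁻¹ : (Matrix (Fin N) (Fin N) ℂ)ˣ) : Matrix (Fin N) (Fin N) ℂ)‖ ≤ 1)
    (hFr : ∀ z, ‖(Fr z : Matrix (Fin N) (Fin N) ℂ)‖ ≤ 1 ∧ ‖(((Fr z)⁻¹ : (Matrix (Fin N) (Fin N) ℂ)ˣ) : Matrix (Fin N) (Fin N) ℂ)‖ ≤ 1)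
    (V : Site P j → Matrix (Fin N) (Fin N) ℂ) (y : Site P j) {m : ℕ} (hm : 16 ≤ m)
    (hV : ∀ z, 0 < Site.tdist z y → Site.tdist z y ≤ 2 * m → divB (torusT P j) U (fun μ => covD (torusT P j) U μ V) z = 0)
    {ℓ t τ₁ τ₂ : ℝ} (hℓ : 1024 ≤ ℓ) (hm2 : 2 * (m : ℝ) + 1 ≤ ℓ) (ht : 0 ≤ t) (hτ₁ : τ₁ ≤ t / ℓ) (hτ₂ : τ₂ ≤ t / ℓ ^ 2)
    (hrow1 : ∀ (μ : Fin P.d) (z : Site P j), Site.tdist z y ≤ m + 1 →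
      ‖(((Fr z)⁻¹ * U μ z * Fr (torusT P j μ z) : (Matrix (Fin N) (Fin N) ℂ)ˣ) : Matrix (Fin N) (Fin N) ℂ) - 1‖ ≤ τ₁)
    (hrow2 : ∀ (μ : Fin P.d) (z : Site P j), Site.tdist z y ≤ m →
      ‖(((Fr z)⁻¹ * U μ z * Fr (torusT P j μ z) : (Matrix (Fin N) (Fin N) ℂ)ˣ) : Matrix (Fin N) (Fin N) ℂ)
        - (((Fr (z.unshift μ))⁻¹ * U μ (z.unshift μ) * Fr (torusT P j μ (z.unshift μ)) : (Matrix (Fin N) (Fin N) ℂ)ˣ) : Matrix (Fin N) (Fin N) ℂ)‖ ≤ τ₂) :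
    ∑ z ∈ Finset.univ.filter (fun z : Site P j => 1 ≤ Site.tdist z y ∧ Site.tdist z y ≤ m),
        ((Site.tdist z y : ℕ) : ℝ) ^ 2 * ‖laplace 1 (fun w => R (Fr w)⁻¹ (V w)) z‖ ^ 2
      ≤ 29088 * t ^ 2 * (1 + t) ^ 2 / ℓ ^ 2
          * ∑ z ∈ Finset.univ.filter (fun z : Site P j => Site.tdist z y ≤ 2 * m + 1), ∑ j' : Fin N, ∑ k' : Fin N, ‖(V z) j' k'‖ ^ 2 := by
  have hm3 : 3 ≤ m := by omega
  have hJ := J2_le U Fr hd hUu hU hFr V y hm3 hV hrow1 hrow2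
  have hτ₁0 : 0 ≤ τ₁ := (norm_nonneg _).trans (hrow1 ⟨0, P.hd⟩ y (by rw [tdist_self]; omega))
  have hτ₂0 : 0 ≤ τ₂ := (norm_nonneg _).trans (hrow2 ⟨0, P.hd⟩ y (by rw [tdist_self]; omega))
  have hℓ1 : 1 ≤ ℓ := by linarith
  have hc := cJ2_le ht hℓ1 hτ₁0 hτ₂0 hτ₁ hτ₂ (Nat.cast_nonneg m) (by linarith : (m : ℝ) ≤ ℓ / 2)
  exact hJ.trans (mul_le_mul_of_nonneg_right hc (Finset.sum_nonneg fun _ _ => Finset.sum_nonneg fun _ _ => Finset.sum_nonneg fun _ _ => sq_nonneg _))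

/-- ★ **`J₁` SCALED**: `Σ_{0<s≤m} ‖Δ₁v‖ ≤ 1200·t(1+t)·√𝓜∕√ℓ` (✓ `J1_le` + `cJ1_le`). [cite: Giaquinta1984, Ch. III §2; Balaban1985BackgroundPropagators, (3.35) p.396] -/
theorem J1_scaled_le (hd : P.d = 3) (hUu : ∀ ν x, (U ν x : Matrix (Fin N) (Fin N) ℂ) ∈ unitary (Matrix (Fin N) (Fin N) ℂ))
    (hU : ∀ (κ : Fin P.d) (w : Site P j), ‖(U κ w : Matrix (Fin N) (Fin N) ℂ)‖ ≤ 1 ∧ ‖(((U κ w)⁻¹ : (Matrix (Fin N) (Fin N) ℂ)ˣ) : Matrix (Fin N) (Fin N) ℂ)‖ ≤ 1)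
    (hFr : ∀ z, ‖(Fr z : Matrix (Fin N) (Fin N) ℂ)‖ ≤ 1 ∧ ‖(((Fr z)⁻¹ : (Matrix (Fin N) (Fin N) ℂ)ˣ) : Matrix (Fin N) (Fin N) ℂ)‖ ≤ 1)
    (V : Site P j → Matrix (Fin N) (Fin N) ℂ) (y : Site P j) {m : ℕ} (hm : 16 ≤ m)
    (hV : ∀ z, 0 < Site.tdist z y → Site.tdist z y ≤ 2 * m → divB (torusT P j) U (fun μ => covD (torusT P j) U μ V) z = 0)
    {ℓ t τ₁ τ₂ : ℝ} (hℓ : 1024 ≤ ℓ) (hm2 : 2 * (m : ℝ) + 1 ≤ ℓ) (ht : 0 ≤ t) (hτ₁ : τ₁ ≤ t / ℓ) (hτ₂ : τ₂ ≤ t / ℓ ^ 2)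
    (hrow1 : ∀ (μ : Fin P.d) (z : Site P j), Site.tdist z y ≤ m + 1 →
      ‖(((Fr z)⁻¹ * U μ z * Fr (torusT P j μ z) : (Matrix (Fin N) (Fin N) ℂ)ˣ) : Matrix (Fin N) (Fin N) ℂ) - 1‖ ≤ τ₁)
    (hrow2 : ∀ (μ : Fin P.d) (z : Site P j), Site.tdist z y ≤ m →
      ‖(((Fr z)⁻¹ * U μ z * Fr (torusT P j μ z) : (Matrix (Fin N) (Fin N) ℂ)ˣ) : Matrix (Fin N) (Fin N) ℂ)
        - (((Fr (z.unshift μ))⁻¹ * U μ (z.unshift μ) * Fr (torusT P j μ (z.unshift μ)) : (Matrix (Fin N) (Fin N) ℂ)ˣ) : Matrix (Fin N) (Fin N) ℂ)‖ ≤ τ₂) :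
    ∑ z ∈ Finset.univ.filter (fun z : Site P j => 1 ≤ Site.tdist z y ∧ Site.tdist z y ≤ m), ‖laplace 1 (fun w => R (Fr w)⁻¹ (V w)) z‖
      ≤ 1200 * t * (1 + t) * Real.sqrt (∑ z ∈ Finset.univ.filter (fun z : Site P j => Site.tdist z y ≤ 2 * m + 1), ∑ j' : Fin N, ∑ k' : Fin N, ‖(V z) j' k'‖ ^ 2)
          / Real.sqrt ℓ := by
  have hm3 : 3 ≤ m := by omega
  have hJ := J1_le U Fr hd hUu hU hFr V y hm3 hV hrow1 hrow2
  have hd' : (P.d : ℝ) = 3 := by exact_mod_cast hd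
  rw [hd'] at hJ
  have e : (36 : ℝ) * 3 = 108 := by norm_num
  rw [e] at hJ
  have hτ₁0 : 0 ≤ τ₁ := (norm_nonneg _).trans (hrow1 ⟨0, P.hd⟩ y (by rw [tdist_self]; omega))
  have hτ₂0 : 0 ≤ τ₂ := (norm_nonneg _).trans (hrow2 ⟨0, P.hd⟩ y (by rw [tdist_self]; omega))
  have hℓ1 : 1 ≤ ℓ := by linarith
  have hm1 : ((m + 1 : ℕ) : ℝ) + 1 ≤ ℓ := by push_cast; linarith [show (3 : ℝ) ≤ m by exact_mod_cast hm3]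
  exact hJ.trans (cJ1_le ht hℓ1 hτ₁0 hτ₂0 hτ₁ hτ₂ (by positivity) hm1)

end Junk

end Summit.QuantumFields.YangMills.Theorems.Prop7CovWeightedRowBricks

end
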